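import Mathlib

/-!
# The large sieve inequality (additive form, well-spaced points and Farey fractions)

This file proves, with complete proofs and explicit constants, the **analytic large sieve
inequality** in the form of Davenport–Bombieri–Huxley: if the real points `x_r` (`r ∈ R`) are
`δ`-spaced modulo `1`, then for complex numbers `a_n` supported on `M₀ < n ≤ M₀ + N`,

  `∑_r |∑_n a_n e(n x_r)|² ≤ (N + 1 + 2δ⁻¹) ∑_n |a_n|²`   (`largeSieve_wellSpaced`),

and its corollary at the Farey points `b/q`, `q ≤ Q`, `(b, q) = 1` (which are `Q⁻²`-spaced),

  `∑_{q ≤ Q} ∑*_{b mod q} |∑_n a_n e(bn/q)|² ≤ (N + 1 + 2Q²) ∑_n |a_n|²`   (`largeSieve_farey`).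

The second statement has exactly the shape of the named fact `Literature.NumberTheory.Sieve.large_sieve_inequality`
(parity.S33, `ParityWave0.lean`), whose constant `Q² + N − 1` (Selberg; Montgomery–Vaughan 1973)
is optimal; the weaker constant proved here is all that the Bombieri–Vinogradov theorem and
Vaughan's mean value theorem (`Literature.NumberTheory.Sieve.vaughan_meanValue`) require, and this file is the first
layer of the discharge of those facts.

## The argument (Huxley 1972, ch. 7, (7.9)–(7.25); the proof is Bombieri's)

* **Duality** (`duality`, Huxley's Lemma and Corollary (7.15)): for vectors `u`, `f_r` and any
  `B` with `∑_s |⟨f_r, f_s⟩| ≤ B` for every `r`, `∑_r |⟨u, f_r⟩|² ≤ ‖u‖² B` (Cauchy–Schwarz twice).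
* **The trapezoid kernel** (`trapW`, `trapK`, Huxley (7.19)–(7.23)): with weights `w(m) = 1` for
  `|m − c| ≤ M`, decreasing linearly to `0` at `|m − c| = M + L`, written as the average
  `w(m) = L⁻¹ #{J ∈ [M, M+L) : |m − c| ≤ J}` of indicators of centred intervals, the kernel
  `K(α) = ∑_m w(m) e(mα)` is an average of `L` geometric progressions, whence
  `|K(α)| ≤ 4 / (L |e(α) − 1|²) = 1/(L sin² πα)` (`norm_trapK_le`, Huxley (7.24)) and
  `K(0) = 2M + L` (`trapK_zero`).
* **Spacing** (`sum_inv_sq_le_of_separated`): for a `δ`-separated finite set `T ⊆ [δ, ∞)`,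
  `∑_{t ∈ T} t⁻² ≤ 2δ⁻²` (the `k`-th smallest element is `≥ kδ`, and `∑ k⁻² ≤ 2`); with Jordan's
  inequality `sin πu ≥ 2u` on `[0, 1/2]` this bounds the off-diagonal row sums
  `∑_{s ≠ r} |K(x_s − x_r)| ≤ (L δ²)⁻¹` (`sum_erase_norm_trapK_le`).
* Taking `f_r(m) = √w(m) e(−m x_r)` on the window `|m − c| ≤ M + L` (so that `⟨u, f_r⟩` is the
  exponential sum, `w = 1` on the support of `a`) and `L = ⌈δ⁻¹⌉` gives the theorem with
  `B = 2M + L + (Lδ²)⁻¹ ≤ N + 1 + 2δ⁻¹` (Huxley optimises `L ≈ (δ√3)⁻¹` to get (7.8),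
  `N + (2/√3)δ⁻¹ + O(1)`; we do not).
* **Farey points** (`farey_spacing`): for `b/q ≠ b'/q'` with `q, q' ≤ Q`,
  `|b'/q' − b/q − k| ≥ 1/(qq') ≥ Q⁻²` for every integer `k`.

## Design

* `e t` is an abbreviation for Mathlib's additive character `Real.fourierChar`, `𝐞 t = exp(2πit)`,
  coerced from `Circle` to `ℂ`; the small `e`-API below (`e_add`, `norm_e_sub_one`, …) only
  repackages Mathlib lemmas in this coercion.
* Everything is a finite sum; no measure theory is used. All declarations live in the namespace
  `Literature.Parity.LargeSieve`.

## References

* M. N. Huxley, *The Distribution of Prime Numbers. Large Sieves and Zero-Density Theorems*,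
  Oxford Mathematical Monographs (Clarendon Press, 1972), ch. 7, (7.8)–(7.25). [Huxley1972]
* E. Bombieri, *On the large sieve*, Mathematika 12 (1965), 201–225. [Bombieri1965]
* H. L. Montgomery, R. C. Vaughan, *The large sieve*, Mathematika 20 (1973), 119–134, Thm 1
  (the optimal constant, parity.S33).
* H. Iwaniec, E. Kowalski, *Analytic Number Theory* (AMS, 2004), Thm 7.7 and Thm 7.11.
  [IwaniecKowalski2004]
-/

open Finset Real Complex
open scoped ComplexConjugate FourierTransform

namespace Literature.NumberTheory.Sieve.LargeSieve

/-! ### The additive character `e(t) = exp(2πit)` -/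

/-- `e(t) = 𝐞(t) = exp(2πit)` as a complex number: Mathlib's additive character
`Real.fourierChar` (notation `𝐞`, valued in `Circle`) followed by the coercion `Circle → ℂ`.
An abbreviation, introduced only to keep the formulas below short. [folklore] -/
noncomputable abbrev e (t : ℝ) : ℂ := 𝐞 t

/-- `e(t) = exp(2πit)`. [folklore] -/
theorem e_eq_exp (t : ℝ) : e t = Complex.exp (I * (2 * π * t : ℝ)) := by
  rw [e, Real.fourierChar_apply, mul_comm]

/-- `e(s + t) = e(s) e(t)`. [folklore] -/
theorem e_add (s t : ℝ) : e (s + t) = e s * e t := by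
  rw [e_eq_exp, e_eq_exp, e_eq_exp, ← Complex.exp_add]; congr 1; push_cast; ring

/-- `|e(t)| = 1`. [folklore] -/
theorem norm_e (t : ℝ) : ‖e t‖ = 1 := Circle.norm_coe _

/-- `e(0) = 1`. [folklore] -/
theorem e_zero : e 0 = 1 := by simp [e_eq_exp]

/-- `e(n) = 1` for integers `n`. [folklore] -/
theorem e_int (n : ℤ) : e n = 1 := by
  rw [e_eq_exp, ← Complex.exp_int_mul_two_pi_mul_I n]; congr 1; push_cast; ring

/-- `conj e(t) = e(-t)`. [folklore] -/
theorem conj_e (t : ℝ) : conj (e t) = e (-t) := by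
  rw [e_eq_exp, e_eq_exp, ← Complex.exp_conj, map_mul, Complex.conj_I, Complex.conj_ofReal]
  congr 1; push_cast; ring

/-- `e(s - t) = e(s) conj e(t)`. [folklore] -/
theorem e_sub (s t : ℝ) : e (s - t) = e s * conj (e t) := by
  rw [sub_eq_add_neg, e_add, conj_e]

/-- `e(nt) = e(t)ⁿ`. [folklore] -/
theorem e_nat_mul (n : ℕ) (t : ℝ) : e (n * t) = e t ^ n := by
  rw [e_eq_exp, e_eq_exp, ← Complex.exp_nat_mul]; congr 1; push_cast; ring

/-- `e(t + n) = e(t)` for integers `n`. [folklore] -/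
theorem e_add_int (t : ℝ) (n : ℤ) : e (t + n) = e t := by rw [e_add, e_int, mul_one]

/-- `e(t) conj e(t) = 1`. [folklore] -/
theorem e_mul_conj (t : ℝ) : e t * conj (e t) = 1 := by
  rw [← e_sub, sub_self, e_zero]

/-- `|e(t) - 1| = 2 |sin(πt)|`. [folklore] -/
theorem norm_e_sub_one (t : ℝ) : ‖e t - 1‖ = 2 * |Real.sin (π * t)| := by
  rw [e_eq_exp, Complex.norm_exp_I_mul_ofReal_sub_one, show 2 * π * t / 2 = π * t by ring,
    Real.norm_eq_abs, abs_mul, abs_two]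

/-- `|e(-t) - 1| = |e(t) - 1|`. [folklore] -/
theorem norm_e_neg_sub_one (t : ℝ) : ‖e (-t) - 1‖ = ‖e t - 1‖ := by
  rw [← conj_e, ← Complex.norm_conj (e t - 1), map_sub, map_one]

/-- `|sin(πt)|` only depends on `t mod 1`. [folklore] -/
theorem abs_sin_pi_mul_eq_fract (t : ℝ) :
    |Real.sin (π * t)| = |Real.sin (π * Int.fract t)| := by
  conv_lhs => rw [← Int.fract_add_floor t]
  rw [mul_add, show π * ((⌊t⌋ : ℤ) : ℝ) = ((⌊t⌋ : ℤ) : ℝ) * π by ring, Real.sin_add_int_mul_pi,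
    abs_mul, abs_zpow, abs_neg, abs_one, one_zpow, one_mul]

/-- Jordan's inequality in the form `2u ≤ sin(πu)` on `[0, 1/2]`. [folklore] -/
theorem two_mul_le_sin_pi_mul {u : ℝ} (h0 : 0 ≤ u) (h1 : u ≤ 1 / 2) :
    2 * u ≤ Real.sin (π * u) := by
  have h := Real.mul_le_sin (x := π * u) (by positivity) (by nlinarith [Real.pi_pos])
  calc 2 * u = 2 / π * (π * u) := by field_simp
    _ ≤ _ := h

/-- For `0 < u < 1`: `1/sin²(πu) ≤ (1/4)(1/u² + 1/(1-u)²)`. [folklore] -/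
theorem inv_sin_sq_le {u : ℝ} (h0 : 0 < u) (h1 : u < 1) :
    (Real.sin (π * u) ^ 2)⁻¹ ≤ 4⁻¹ * ((u ^ 2)⁻¹ + ((1 - u) ^ 2)⁻¹) := by
  have hsymm : Real.sin (π * (1 - u)) = Real.sin (π * u) := by
    rw [mul_sub, mul_one, Real.sin_pi_sub]
  rcases le_or_gt u (1 / 2) with hu | hu
  · have h2 := two_mul_le_sin_pi_mul h0.le hu
    have h3 : (2 * u) ^ 2 ≤ Real.sin (π * u) ^ 2 := pow_le_pow_left₀ (by positivity) h2 2
    have h4 : 0 ≤ ((1 - u) ^ 2)⁻¹ := by positivity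
    calc (Real.sin (π * u) ^ 2)⁻¹ ≤ ((2 * u) ^ 2)⁻¹ := inv_anti₀ (by positivity) h3
      _ = 4⁻¹ * (u ^ 2)⁻¹ := by rw [mul_pow, mul_inv]; norm_num
      _ ≤ _ := by nlinarith
  · have h2 := two_mul_le_sin_pi_mul (u := 1 - u) (by linarith) (by linarith)
    rw [hsymm] at h2
    have h1' : 0 < 1 - u := by linarith
    have h3 : (2 * (1 - u)) ^ 2 ≤ Real.sin (π * u) ^ 2 := pow_le_pow_left₀ (by positivity) h2 2
    have h4 : 0 ≤ (u ^ 2)⁻¹ := by positivity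
    calc (Real.sin (π * u) ^ 2)⁻¹ ≤ ((2 * (1 - u)) ^ 2)⁻¹ := inv_anti₀ (by positivity) h3
      _ = 4⁻¹ * ((1 - u) ^ 2)⁻¹ := by rw [mul_pow, mul_inv]; norm_num
      _ ≤ _ := by nlinarith

/-- `|e(t) - 1|² = 4 sin²(π {t})`. [folklore] -/
theorem norm_e_sub_one_sq (t : ℝ) : ‖e t - 1‖ ^ 2 = 4 * Real.sin (π * Int.fract t) ^ 2 := by
  rw [norm_e_sub_one, abs_sin_pi_mul_eq_fract, mul_pow, sq_abs]; norm_num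

/-- A geometric progression on the unit circle: `|∑_{j<n} zʲ| ≤ 2/|z - 1|`. [folklore] -/
theorem norm_geom_sum_le {z : ℂ} (hz : ‖z‖ = 1) (hz1 : z ≠ 1) (n : ℕ) :
    ‖∑ j ∈ range n, z ^ j‖ ≤ 2 / ‖z - 1‖ := by
  rw [geom_sum_eq hz1, norm_div]
  gcongr
  exact (norm_sub_le _ _).trans (by rw [norm_pow, hz, one_pow, norm_one]; norm_num)

/-! ### The trapezoid kernel -/

section Kernel

variable (c : ℤ) (M L : ℕ)

/-- The trapezoid weight `w(m) = (1/L) #{J ∈ [M, M+L) : |m - c| ≤ J}`: equal to `1` for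
`|m - c| ≤ M`, decreasing linearly to `0` at `|m - c| = M + L` (Huxley 1972, (7.19), squared).
[cite: Huxley1972, Ch. 7, (7.19)] -/
noncomputable def trapW (m : ℤ) : ℝ :=
  (#((Ico M (M + L)).filter fun J : ℕ => |m - c| ≤ (J : ℤ)) : ℝ) / L

/-- `w ≥ 0`. [folklore] -/
theorem trapW_nonneg (m : ℤ) : 0 ≤ trapW c M L m := by unfold trapW; positivity

/-- `w = 1` on the plateau `|m - c| ≤ M`. [folklore] -/
theorem trapW_eq_one (hL : 0 < L) {m : ℤ} (hm : |m - c| ≤ M) : trapW c M L m = 1 := by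
  unfold trapW
  rw [Finset.filter_true_of_mem, Nat.card_Ico, Nat.add_sub_cancel_left,
    div_self (by exact_mod_cast hL.ne')]
  intro J hJ
  rw [mem_Ico] at hJ
  calc |m - c| ≤ M := hm
    _ ≤ J := by exact_mod_cast hJ.1

/-- The index window `[c - M - L, c + M + L]`. [folklore] -/
noncomputable def window : Finset ℤ := Icc (c - (M + L : ℕ)) (c + (M + L : ℕ))

/-- The kernel `K(α) = ∑_m w(m) e(mα)` (Huxley 1972, (7.23)). [cite: Huxley1972, Ch. 7, (7.23)] -/
noncomputable def trapK (α : ℝ) : ℂ := ∑ m ∈ window c M L, (trapW c M L m : ℂ) * e (m * α)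

/-- Slices of the window: `{m ∈ window : |m - c| ≤ J} = [c - J, c + J]` for `J ≤ M + L`.
[folklore] -/
theorem filter_window_eq {J : ℕ} (hJ : J ≤ M + L) :
    (window c M L).filter (fun m => |m - c| ≤ (J : ℤ)) = Icc (c - J) (c + J) := by
  ext m
  simp only [window, mem_filter, mem_Icc, abs_le]
  omega

/-- Sums over an integer interval as sums over `range`. [folklore] -/
theorem sum_Icc_int_eq_sum_range {A : Type*} [AddCommMonoid A] (a : ℤ) (n : ℕ) (g : ℤ → A) :
    ∑ m ∈ Icc a (a + n), g m = ∑ k ∈ range (n + 1), g (a + k) := by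
  rw [Int.Icc_eq_finset_map, Finset.sum_map]
  have : (a + n + 1 - a).toNat = n + 1 := by omega
  rw [this]
  rfl

/-- The slice sums are geometric: `(e(α) - 1) ∑_{|m-c| ≤ J} e(mα) = e((c+J+1)α) - e((c-J)α)`.
[folklore] -/
theorem e_sub_one_mul_sum_Icc (J : ℕ) (α : ℝ) :
    (e α - 1) * ∑ m ∈ Icc (c - J) (c + J), e (m * α) =
      e ((c + J + 1 : ℤ) * α) - e ((c - J : ℤ) * α) := by
  have h := sum_Icc_int_eq_sum_range (c - J) (2 * J) (fun m => e (m * α))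
  rw [show c - (J : ℤ) + ((2 * J : ℕ) : ℤ) = c + J by push_cast; ring] at h
  rw [h]
  have h2 : ∀ k ∈ range (2 * J + 1), e (((c - J + k : ℤ)) * α) = e ((c - J : ℤ) * α) * e α ^ k := by
    intro k _
    rw [← e_nat_mul, ← e_add]; congr 1; push_cast; ring
  simp only [Int.cast_add, Int.cast_sub, Int.cast_natCast] at h2 ⊢
  rw [sum_congr rfl h2, ← mul_sum, mul_left_comm, mul_comm (e α - 1), geom_sum_mul, mul_sub, mul_one,
    ← e_nat_mul, ← e_add]
  congr 2; push_cast; ring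

/-- The weight as an average of indicators (cast to `ℂ`). [folklore] -/
theorem trapW_cast (m : ℤ) : (trapW c M L m : ℂ) =
    (L : ℂ)⁻¹ * ∑ J ∈ Ico M (M + L), (if |m - c| ≤ (J : ℤ) then (1 : ℂ) else 0) := by
  unfold trapW
  rw [card_filter]
  push_cast
  rw [div_eq_inv_mul]
  congr 1
  exact sum_congr rfl fun J _ => by split_ifs <;> simp

/-- `K(α) = (1/L) ∑_{J ∈ [M, M+L)} ∑_{|m - c| ≤ J} e(mα)`. [folklore] -/
theorem trapK_eq (α : ℝ) :
    trapK c M L α = (L : ℂ)⁻¹ * ∑ J ∈ Ico M (M + L), ∑ m ∈ Icc (c - (J : ℤ)) (c + J), e (m * α) := by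
  unfold trapK
  simp only [trapW_cast, mul_assoc, ← mul_sum]
  congr 1
  simp only [sum_mul]
  rw [sum_comm]
  refine sum_congr rfl fun J hJ => ?_
  rw [← filter_window_eq c M L (by rw [mem_Ico] at hJ; omega), sum_filter]
  refine sum_congr rfl fun m _ => ?_
  split_ifs <;> simp

/-- **Kernel bound** (Huxley 1972, (7.24): `|K(α)| ≤ 1/(L sin² πα)`):
`|K(α)| ≤ 4 / (L |e(α) - 1|²)` for `e(α) ≠ 1`. [cite: Huxley1972, Ch. 7, (7.24)] -/
theorem norm_trapK_le (hL : 0 < L) {α : ℝ} (hα : e α ≠ 1) :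
    ‖trapK c M L α‖ ≤ 4 / (L * ‖e α - 1‖ ^ 2) := by
  have hL' : (0 : ℝ) < L := by exact_mod_cast hL
  have hne : e α - 1 ≠ 0 := sub_ne_zero.2 hα
  have hpos : 0 < ‖e α - 1‖ := norm_pos_iff.2 hne
  set G : ℕ → ℂ := fun J => ∑ m ∈ Icc (c - (J : ℤ)) (c + J), e (m * α) with hG
  -- `(e α - 1) ∑_J G_J = A - B` with two geometric progressions `A`, `B`.
  have hA : ∑ J ∈ Ico M (M + L), e ((c + J + 1 : ℤ) * α) =
      e ((c + M + 1 : ℤ) * α) * ∑ j ∈ range L, e α ^ j := by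
    rw [Finset.sum_Ico_eq_sum_range, Nat.add_sub_cancel_left, mul_sum]
    refine sum_congr rfl fun j _ => ?_
    rw [← e_nat_mul, ← e_add]; congr 1; push_cast; ring
  have hB : ∑ J ∈ Ico M (M + L), e ((c - J : ℤ) * α) =
      e ((c - M : ℤ) * α) * ∑ j ∈ range L, e (-α) ^ j := by
    rw [Finset.sum_Ico_eq_sum_range, Nat.add_sub_cancel_left, mul_sum]
    refine sum_congr rfl fun j _ => ?_
    rw [← e_nat_mul, ← e_add]; congr 1; push_cast; ring
  have hkey : (e α - 1) * ∑ J ∈ Ico M (M + L), G J =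
      e ((c + M + 1 : ℤ) * α) * ∑ j ∈ range L, e α ^ j -
        e ((c - M : ℤ) * α) * ∑ j ∈ range L, e (-α) ^ j := by
    rw [mul_sum, ← hA, ← hB, ← sum_sub_distrib]
    exact sum_congr rfl fun J _ => e_sub_one_mul_sum_Icc c J α
  have hnormsum : ‖∑ J ∈ Ico M (M + L), G J‖ ≤ 4 / ‖e α - 1‖ ^ 2 := by
    have h1 : ‖e α - 1‖ * ‖∑ J ∈ Ico M (M + L), G J‖ ≤ 4 / ‖e α - 1‖ := by
      rw [← norm_mul, hkey]
      refine (norm_sub_le _ _).trans ?_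
      rw [norm_mul, norm_mul, norm_e, norm_e, one_mul, one_mul]
      have hzα : ‖e (-α)‖ = 1 := norm_e _
      have hα' : e (-α) ≠ 1 := by
        intro h; apply hα
        have := congr_arg conj h
        rwa [conj_e, neg_neg, map_one] at this
      calc ‖∑ j ∈ range L, e α ^ j‖ + ‖∑ j ∈ range L, e (-α) ^ j‖
          ≤ 2 / ‖e α - 1‖ + 2 / ‖e (-α) - 1‖ :=
            add_le_add (norm_geom_sum_le (norm_e α) hα L) (norm_geom_sum_le hzα hα' L)
        _ = 4 / ‖e α - 1‖ := by rw [norm_e_neg_sub_one]; ring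
    rw [le_div_iff₀ (by positivity)]
    calc ‖∑ J ∈ Ico M (M + L), G J‖ * ‖e α - 1‖ ^ 2
        = ‖e α - 1‖ * ‖∑ J ∈ Ico M (M + L), G J‖ * ‖e α - 1‖ := by ring
      _ ≤ 4 / ‖e α - 1‖ * ‖e α - 1‖ := mul_le_mul_of_nonneg_right h1 hpos.le
      _ = 4 := div_mul_cancel₀ _ hpos.ne'
  rw [trapK_eq c M L, norm_mul, norm_inv, Complex.norm_natCast, div_eq_mul_inv, mul_inv,
    mul_comm (4 : ℝ), mul_assoc]
  gcongr
  rw [← div_eq_inv_mul]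
  exact hnormsum

/-- `K(0) = ∑_m w(m) = 2M + L`. [folklore] -/
theorem trapK_zero (hL : 0 < L) : trapK c M L 0 = (2 * M + L : ℕ) := by
  rw [trapK_eq c M L]
  simp only [mul_zero, e_zero, sum_const, nsmul_eq_mul, mul_one, Int.card_Icc]
  have h1 : ∀ J ∈ Ico M (M + L), ((c + (J : ℤ) + 1 - (c - J)).toNat : ℂ) = 2 * J + 1 := by
    intro J _
    have : (c + (J : ℤ) + 1 - (c - J)).toNat = 2 * J + 1 := by omega
    rw [this]; push_cast; ring
  rw [sum_congr rfl h1]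
  have h2 : ∀ L' : ℕ, ∑ J ∈ Ico M (M + L'), (2 * (J : ℂ) + 1) = L' * (2 * M + L') := by
    intro L'
    induction L' with
    | zero => simp
    | succ n ih =>
      rw [← Nat.add_assoc, Finset.sum_Ico_succ_top (by omega), ih]; push_cast; ring
  rw [h2, ← mul_assoc, inv_mul_cancel₀ (by exact_mod_cast hL.ne'), one_mul]
  push_cast; ring

end Kernel


/-! ### Duality -/

/-- **Duality lemma of the large sieve** (Huxley 1972, ch. 7, Lemma and Corollary (7.15);
Bombieri; the `ℓ²` form of Selberg's duality principle). For vectors `u, f_r : κ → ℂ` on a finite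
index set `S` and any `B ≥ 0` with `∑_s |⟨f_r, f_s⟩| ≤ B` for every `r`, one has
`∑_r |⟨u, f_r⟩|² ≤ ‖u‖² B`. [cite: Huxley1972, Ch. 7, (7.11)–(7.15)] -/
theorem duality {ι κ : Type*} (R : Finset ι) (S : Finset κ) (u : κ → ℂ) (f : ι → κ → ℂ)
    {B : ℝ} (hB0 : 0 ≤ B)
    (hB : ∀ r ∈ R, ∑ s ∈ R, ‖∑ n ∈ S, f r n * conj (f s n)‖ ≤ B) :
    ∑ r ∈ R, ‖∑ n ∈ S, u n * conj (f r n)‖ ^ 2 ≤ (∑ n ∈ S, ‖u n‖ ^ 2) * B := by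
  obtain ⟨c, hc⟩ : ∃ c : ι → ℂ, ∀ r, c r = ∑ n ∈ S, u n * conj (f r n) := ⟨_, fun _ => rfl⟩
  obtain ⟨v, hv⟩ : ∃ v : κ → ℂ, ∀ n, v n = ∑ r ∈ R, c r * f r n := ⟨_, fun _ => rfl⟩
  obtain ⟨G, hG⟩ : ∃ G : ι → ι → ℝ, ∀ r s, G r s = ‖∑ n ∈ S, f r n * conj (f s n)‖ :=
    ⟨_, fun _ _ => rfl⟩
  set U : ℝ := ∑ n ∈ S, ‖u n‖ ^ 2 with hU
  set Sig : ℝ := ∑ r ∈ R, ‖c r‖ ^ 2 with hSig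
  simp only [← hc]
  have hU0 : 0 ≤ U := sum_nonneg fun n _ => by positivity
  have hSig0 : 0 ≤ Sig := sum_nonneg fun n _ => by positivity
  have hGsymm : ∀ r s, G r s = G s r := fun r s => by
    rw [hG, hG, ← Complex.norm_conj, map_sum]
    refine congr_arg _ (sum_congr rfl fun n _ => ?_)
    rw [map_mul, Complex.conj_conj, mul_comm]
  have hG0 : ∀ r s, 0 ≤ G r s := fun r s => by rw [hG]; exact norm_nonneg _
  -- Step 1: `Sig = ⟨u, v⟩`.
  have h1 : (Sig : ℂ) = ∑ n ∈ S, u n * conj (v n) := by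
    have e1 : ∀ r, ((‖c r‖ ^ 2 : ℝ) : ℂ) = conj (c r) * ∑ n ∈ S, u n * conj (f r n) :=
      fun r => by
        rw [← hc r, mul_comm, Complex.mul_conj, Complex.normSq_eq_norm_sq]
    simp only [hSig, Complex.ofReal_sum, e1, mul_sum]
    rw [sum_comm]
    refine sum_congr rfl fun n _ => ?_
    rw [hv, map_sum, mul_sum]
    refine sum_congr rfl fun r _ => ?_
    rw [map_mul]; ring
  -- Step 2: Cauchy–Schwarz, `Sig² ≤ ‖u‖² ‖v‖²`.
  have h2 : Sig ^ 2 ≤ U * ∑ n ∈ S, ‖v n‖ ^ 2 := by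
    have e2 : Sig = ‖∑ n ∈ S, u n * conj (v n)‖ := by
      rw [← h1, Complex.norm_real, Real.norm_of_nonneg hSig0]
    have e3 : ‖∑ n ∈ S, u n * conj (v n)‖ ≤ ∑ n ∈ S, ‖u n‖ * ‖v n‖ :=
      (norm_sum_le _ _).trans (le_of_eq (sum_congr rfl fun n _ => by
        rw [norm_mul, Complex.norm_conj]))
    calc Sig ^ 2 = ‖∑ n ∈ S, u n * conj (v n)‖ ^ 2 := by rw [← e2]
      _ ≤ (∑ n ∈ S, ‖u n‖ * ‖v n‖) ^ 2 := pow_le_pow_left₀ (norm_nonneg _) e3 2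
      _ ≤ U * ∑ n ∈ S, ‖v n‖ ^ 2 := sum_mul_sq_le_sq_mul_sq S _ _
  -- Step 3: `‖v‖² ≤ B Sig`.
  have h3 : ∑ n ∈ S, ‖v n‖ ^ 2 ≤ B * Sig := by
    have e3 : ((∑ n ∈ S, ‖v n‖ ^ 2 : ℝ) : ℂ) =
        ∑ r ∈ R, ∑ s ∈ R, c r * conj (c s) * ∑ n ∈ S, f r n * conj (f s n) := by
      have e1 : ∀ n, ((‖v n‖ ^ 2 : ℝ) : ℂ) = v n * conj (v n) := fun n => by
        rw [Complex.mul_conj, Complex.normSq_eq_norm_sq]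
      simp only [Complex.ofReal_sum, e1]
      have e4 : ∀ n ∈ S, v n * conj (v n) =
          ∑ r ∈ R, ∑ s ∈ R, c r * conj (c s) * (f r n * conj (f s n)) := fun n _ => by
        rw [hv, map_sum, sum_mul_sum]
        refine sum_congr rfl fun r _ => sum_congr rfl fun s _ => ?_
        rw [map_mul]; ring
      rw [sum_congr rfl e4, sum_comm]
      refine sum_congr rfl fun r _ => ?_
      rw [sum_comm]
      refine sum_congr rfl fun s _ => ?_
      rw [mul_sum]
    have e5 : ∑ n ∈ S, ‖v n‖ ^ 2 =
        ‖∑ r ∈ R, ∑ s ∈ R, c r * conj (c s) * ∑ n ∈ S, f r n * conj (f s n)‖ := by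
      rw [← e3, Complex.norm_real, Real.norm_of_nonneg (sum_nonneg fun n _ => by positivity)]
    calc ∑ n ∈ S, ‖v n‖ ^ 2
        ≤ ∑ r ∈ R, ∑ s ∈ R, ‖c r‖ * ‖c s‖ * G r s := by
          rw [e5]
          refine (norm_sum_le _ _).trans (sum_le_sum fun r _ => (norm_sum_le _ _).trans
            (sum_le_sum fun s _ => le_of_eq ?_))
          rw [norm_mul, norm_mul, Complex.norm_conj, hG]
      _ ≤ ∑ r ∈ R, ∑ s ∈ R, (‖c r‖ ^ 2 / 2 * G r s + ‖c s‖ ^ 2 / 2 * G r s) :=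
          sum_le_sum fun r _ => sum_le_sum fun s _ => by
            rw [← add_mul]
            refine mul_le_mul_of_nonneg_right ?_ (hG0 r s)
            nlinarith [sq_nonneg (‖c r‖ - ‖c s‖)]
      _ = (∑ r ∈ R, ‖c r‖ ^ 2 / 2 * ∑ s ∈ R, G r s) +
            ∑ s ∈ R, ‖c s‖ ^ 2 / 2 * ∑ r ∈ R, G s r := by
          rw [sum_congr rfl fun r _ => sum_add_distrib, sum_add_distrib]
          congr 1
          · exact sum_congr rfl fun r _ => by rw [mul_sum]
          · rw [sum_comm]
            exact sum_congr rfl fun s _ => by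
              rw [mul_sum]; exact sum_congr rfl fun r _ => by rw [hGsymm]
      _ ≤ (∑ r ∈ R, ‖c r‖ ^ 2 / 2 * B) + ∑ s ∈ R, ‖c s‖ ^ 2 / 2 * B := by
          gcongr with r hr s hs
          · simp only [hG]; exact hB r hr
          · simp only [hG]; exact hB s hs
      _ = B * Sig := by rw [hSig, ← sum_mul, ← sum_div]; ring
  -- Step 4: conclude.
  by_contra h
  push Not at h
  have hpos : 0 < Sig := (mul_nonneg hU0 hB0).trans_lt h
  have : Sig * Sig ≤ U * B * Sig := by
    calc Sig * Sig = Sig ^ 2 := (sq Sig).symm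
      _ ≤ U * ∑ n ∈ S, ‖v n‖ ^ 2 := h2
      _ ≤ U * (B * Sig) := mul_le_mul_of_nonneg_left h3 hU0
      _ = U * B * Sig := by ring
  exact absurd (le_of_mul_le_mul_right this hpos) (not_le.2 h)


/-! ### Well-spaced points -/

/-- In a `δ`-separated finite set of reals `≥ δ`, the maximum is at least `δ` times the
cardinality. [folklore] -/
theorem card_mul_le_max_of_separated {δ : ℝ} (T : Finset ℝ) (hT : ∀ t ∈ T, δ ≤ t)
    (hsep : ∀ t ∈ T, ∀ t' ∈ T, t ≠ t' → δ ≤ |t - t'|) (hne : T.Nonempty) :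
    (#T : ℝ) * δ ≤ T.max' hne := by
  classical
  induction T using Finset.induction_on_max with
  | empty => exact absurd hne (by simp)
  | insert a s ha ih =>
    have hmax : (insert a s).max' hne = a := by
      refine le_antisymm (Finset.max'_le _ _ _ fun x hx => ?_) (le_max' _ _ (mem_insert_self a s))
      rcases mem_insert.1 hx with rfl | hx
      · exact le_rfl
      · exact (ha x hx).le
    have has : a ∉ s := fun h => lt_irrefl a (ha a h)
    rw [hmax, card_insert_of_notMem has]
    rcases s.eq_empty_or_nonempty with rfl | hsne
    · simpa using hT a (mem_insert_self a _)
    · have ih' := ih (fun t ht => hT t (mem_insert_of_mem ht))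
        (fun t ht t' ht' => hsep t (mem_insert_of_mem ht) t' (mem_insert_of_mem ht')) hsne
      have hm : s.max' hsne ∈ s := max'_mem s hsne
      have hlt : s.max' hsne < a := ha _ hm
      have hgap : δ ≤ |a - s.max' hsne| :=
        hsep a (mem_insert_self a s) _ (mem_insert_of_mem hm) hlt.ne'
      rw [abs_of_pos (sub_pos.2 hlt)] at hgap
      push_cast
      linarith

/-- `∑_{t ∈ T} 1/t² ≤ ∑_{k < #T} 1/((k+1)δ)²` for a `δ`-separated `T ⊆ [δ, ∞)`. [folklore] -/
theorem sum_inv_sq_le_sum_range_of_separated {δ : ℝ} (hδ : 0 < δ) (T : Finset ℝ)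
    (hT : ∀ t ∈ T, δ ≤ t) (hsep : ∀ t ∈ T, ∀ t' ∈ T, t ≠ t' → δ ≤ |t - t'|) :
    ∑ t ∈ T, (t ^ 2)⁻¹ ≤ ∑ k ∈ range #T, (((k + 1 : ℕ) * δ) ^ 2)⁻¹ := by
  classical
  induction T using Finset.induction_on_max with
  | empty => simp
  | insert a s ha ih =>
    have has : a ∉ s := fun h => lt_irrefl a (ha a h)
    have hT' : ∀ t ∈ s, δ ≤ t := fun t ht => hT t (mem_insert_of_mem ht)
    have hsep' : ∀ t ∈ s, ∀ t' ∈ s, t ≠ t' → δ ≤ |t - t'| :=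
      fun t ht t' ht' => hsep t (mem_insert_of_mem ht) t' (mem_insert_of_mem ht')
    have hne : (insert a s).Nonempty := insert_nonempty a s
    have hmax : (insert a s).max' hne = a := by
      refine le_antisymm (Finset.max'_le _ _ _ fun x hx => ?_) (le_max' _ _ (mem_insert_self a s))
      rcases mem_insert.1 hx with rfl | hx
      · exact le_rfl
      · exact (ha x hx).le
    have hcard := card_mul_le_max_of_separated (insert a s) hT hsep hne
    rw [hmax, card_insert_of_notMem has] at hcard
    rw [sum_insert has, card_insert_of_notMem has, sum_range_succ, add_comm]
    refine add_le_add (ih hT' hsep') ?_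
    have hpos : 0 < ((#s + 1 : ℕ) : ℝ) * δ := by positivity
    exact inv_anti₀ (by positivity) (pow_le_pow_left₀ hpos.le (by exact_mod_cast hcard) 2)

/-- `∑_{k < n} 1/(k+1)² ≤ 2`. [folklore] -/
theorem sum_range_inv_succ_sq_le (n : ℕ) : ∑ k ∈ range n, (((k + 1 : ℕ) : ℝ) ^ 2)⁻¹ ≤ 2 := by
  have h := sum_Ioo_inv_sq_le (α := ℝ) 0 (n + 1)
  rw [Nat.cast_zero, zero_add, div_one] at h
  refine le_trans (le_of_eq ?_) h
  rw [← Finset.Ico_add_one_left_eq_Ioo, Finset.sum_Ico_eq_sum_range]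
  simp only [zero_add, Nat.add_sub_cancel]
  refine sum_congr rfl fun k _ => ?_
  push_cast; ring

/-- **Spacing lemma**: `∑_{t ∈ T} 1/t² ≤ 2/δ²` for a `δ`-separated finite `T ⊆ [δ, ∞)`.
[folklore] -/
theorem sum_inv_sq_le_of_separated {δ : ℝ} (hδ : 0 < δ) (T : Finset ℝ)
    (hT : ∀ t ∈ T, δ ≤ t) (hsep : ∀ t ∈ T, ∀ t' ∈ T, t ≠ t' → δ ≤ |t - t'|) :
    ∑ t ∈ T, (t ^ 2)⁻¹ ≤ 2 / δ ^ 2 := by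
  refine (sum_inv_sq_le_sum_range_of_separated hδ T hT hsep).trans ?_
  have h : ∀ k ∈ range #T, ((((k + 1 : ℕ) : ℝ) * δ) ^ 2)⁻¹ = (((k + 1 : ℕ) : ℝ) ^ 2)⁻¹ * (δ ^ 2)⁻¹ := by
    intro k _; rw [mul_pow, mul_inv]
  rw [sum_congr rfl h, ← sum_mul, div_eq_mul_inv]
  exact mul_le_mul_of_nonneg_right (sum_range_inv_succ_sq_le _) (by positivity)

/-- Injective-image form of the spacing lemma: if `g ≥ δ` on `A` and the values of `g` on `A` are
`δ`-separated, then `∑_{s ∈ A} 1/g(s)² ≤ 2/δ²`. [folklore] -/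
theorem sum_inv_sq_apply_le_of_separated {ι : Type*} {δ : ℝ} (hδ : 0 < δ) (A : Finset ι)
    (g : ι → ℝ) (h1 : ∀ s ∈ A, δ ≤ g s)
    (h2 : ∀ s ∈ A, ∀ s' ∈ A, s ≠ s' → δ ≤ |g s - g s'|) :
    ∑ s ∈ A, (g s ^ 2)⁻¹ ≤ 2 / δ ^ 2 := by
  classical
  have hinj : Set.InjOn g A := by
    intro s hs s' hs' hg
    by_contra hne
    have := h2 s hs s' hs' hne
    rw [hg, sub_self, abs_zero] at this
    exact absurd this (not_le.2 hδ)
  rw [← Finset.sum_image (f := fun t : ℝ => (t ^ 2)⁻¹) hinj]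
  refine sum_inv_sq_le_of_separated hδ _ ?_ ?_
  · intro t ht
    obtain ⟨s, hs, rfl⟩ := mem_image.1 ht
    exact h1 s hs
  · intro t ht t' ht' hne
    obtain ⟨s, hs, rfl⟩ := mem_image.1 ht
    obtain ⟨s', hs', rfl⟩ := mem_image.1 ht'
    exact h2 s hs s' hs' fun h => hne (by rw [h])

/-! ### The large sieve inequality for well-spaced points -/

section WellSpaced

variable {ι : Type*} (R : Finset ι) (x : ι → ℝ) {δ : ℝ}

/-- Off-diagonal kernel sum: for `δ`-spaced points (mod 1),
`∑_{s ≠ r} |K(x_s - x_r)| ≤ 1/(L δ²)` (Huxley 1972, (7.24)). [cite: Huxley1972, Ch. 7, (7.24)] -/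
theorem sum_erase_norm_trapK_le (hδ : 0 < δ)
    (hsep : ∀ r ∈ R, ∀ s ∈ R, r ≠ s → ∀ k : ℤ, δ ≤ |x s - x r - k|)
    (c : ℤ) (M L : ℕ) (hL : 0 < L) [DecidableEq ι] {r : ι} (hr : r ∈ R) :
    ∑ s ∈ R.erase r, ‖trapK c M L (x s - x r)‖ ≤ ((L : ℝ) * δ ^ 2)⁻¹ := by
  classical
  have hL' : (0 : ℝ) < L := by exact_mod_cast hL
  set v : ι → ℝ := fun s => Int.fract (x s - x r) with hv
  have hv_ge : ∀ s ∈ R.erase r, δ ≤ v s := by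
    intro s hs
    have h := hsep r hr s (mem_of_mem_erase hs) (ne_of_mem_erase hs).symm ⌊x s - x r⌋
    rwa [Int.self_sub_floor, abs_of_nonneg (Int.fract_nonneg _)] at h
  have hv_le : ∀ s ∈ R.erase r, δ ≤ 1 - v s := by
    intro s hs
    have h := hsep r hr s (mem_of_mem_erase hs) (ne_of_mem_erase hs).symm (⌊x s - x r⌋ + 1)
    rw [Int.cast_add, Int.cast_one, ← sub_sub, Int.self_sub_floor, abs_sub_comm,
      abs_of_nonneg (by linarith [Int.fract_lt_one (x s - x r)])] at h
    exact h
  have hv_sep : ∀ s ∈ R.erase r, ∀ s' ∈ R.erase r, s ≠ s' → δ ≤ |v s - v s'| := by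
    intro s hs s' hs' hne
    have h := hsep s' (mem_of_mem_erase hs') s (mem_of_mem_erase hs) hne.symm
      (⌊x s - x r⌋ - ⌊x s' - x r⌋)
    have e1 : v s - v s' = x s - x s' - ((⌊x s - x r⌋ - ⌊x s' - x r⌋ : ℤ) : ℝ) := by
      simp only [hv, ← Int.self_sub_floor]; push_cast; ring
    rwa [e1]
  -- pointwise kernel bound
  have key : ∀ s ∈ R.erase r,
      ‖trapK c M L (x s - x r)‖ ≤ (4 * (L : ℝ))⁻¹ * ((v s ^ 2)⁻¹ + ((1 - v s) ^ 2)⁻¹) := by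
    intro s hs
    have h0 : 0 < v s := hδ.trans_le (hv_ge s hs)
    have h1 : v s < 1 := by linarith [hv_le s hs]
    have hsin : 0 < Real.sin (π * v s) :=
      Real.sin_pos_of_pos_of_lt_pi (by positivity) (by nlinarith [Real.pi_pos])
    have hsq : ‖e (x s - x r) - 1‖ ^ 2 = 4 * Real.sin (π * v s) ^ 2 := norm_e_sub_one_sq _
    have hne : e (x s - x r) ≠ 1 := by
      intro h
      rw [h, sub_self, norm_zero, zero_pow two_ne_zero] at hsq
      nlinarith
    calc ‖trapK c M L (x s - x r)‖ ≤ 4 / (L * ‖e (x s - x r) - 1‖ ^ 2) :=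
          norm_trapK_le c M L hL hne
      _ = (L : ℝ)⁻¹ * (Real.sin (π * v s) ^ 2)⁻¹ := by
          rw [hsq]; field_simp
      _ ≤ (L : ℝ)⁻¹ * (4⁻¹ * ((v s ^ 2)⁻¹ + ((1 - v s) ^ 2)⁻¹)) :=
          mul_le_mul_of_nonneg_left (inv_sin_sq_le h0 h1) (by positivity)
      _ = (4 * (L : ℝ))⁻¹ * ((v s ^ 2)⁻¹ + ((1 - v s) ^ 2)⁻¹) := by rw [mul_inv]; ring
  have hsum1 : ∑ s ∈ R.erase r, (v s ^ 2)⁻¹ ≤ 2 / δ ^ 2 :=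
    sum_inv_sq_apply_le_of_separated hδ _ v hv_ge hv_sep
  have hsum2 : ∑ s ∈ R.erase r, ((1 - v s) ^ 2)⁻¹ ≤ 2 / δ ^ 2 := by
    refine sum_inv_sq_apply_le_of_separated hδ _ (fun s => 1 - v s) hv_le ?_
    intro s hs s' hs' hne
    rw [show (1 - v s) - (1 - v s') = -(v s - v s') by ring, abs_neg]
    exact hv_sep s hs s' hs' hne
  calc ∑ s ∈ R.erase r, ‖trapK c M L (x s - x r)‖
      ≤ ∑ s ∈ R.erase r, (4 * (L : ℝ))⁻¹ * ((v s ^ 2)⁻¹ + ((1 - v s) ^ 2)⁻¹) := sum_le_sum key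
    _ = (4 * (L : ℝ))⁻¹ * (∑ s ∈ R.erase r, (v s ^ 2)⁻¹ + ∑ s ∈ R.erase r, ((1 - v s) ^ 2)⁻¹) := by
        rw [← mul_sum, sum_add_distrib]
    _ ≤ (4 * (L : ℝ))⁻¹ * (2 / δ ^ 2 + 2 / δ ^ 2) := by gcongr
    _ = ((L : ℝ) * δ ^ 2)⁻¹ := by field_simp; ring

/-- **The large sieve inequality for well-spaced points** (weak constant). If the points
`x_r` (`r ∈ R`) are `δ`-spaced modulo `1`, i.e. `|x_s - x_r - k| ≥ δ` for `r ≠ s` and all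
integers `k`, then for any complex `a_n` supported on `M₀ < n ≤ M₀ + N`,
`∑_r |∑_n a_n e(n x_r)|² ≤ (N + 1 + 2δ⁻¹) ∑_n |a_n|²`.
This is Bombieri's duality proof as presented by Huxley (1972), ch. 7, (7.15)–(7.25), with the
trapezoid kernel and the crude bound `∑ k⁻² ≤ 2`, whence the constant `N + 1 + 2δ⁻¹` instead
of Huxley's `N + (2/√3)δ⁻¹ + O(1)` in (7.8); the optimal constant `N - 1 + δ⁻¹`
(Selberg, Montgomery–Vaughan) is the named fact `Literature.NumberTheory.Sieve.large_sieve_inequality`.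
[cite: Huxley1972, Ch. 7, (7.8) and (7.15)–(7.25)] -/
theorem largeSieve_wellSpaced (hδ : 0 < δ)
    (hsep : ∀ r ∈ R, ∀ s ∈ R, r ≠ s → ∀ k : ℤ, δ ≤ |x s - x r - k|)
    (a : ℤ → ℂ) (M₀ : ℤ) (N : ℕ) :
    ∑ r ∈ R, ‖∑ n ∈ Ioc M₀ (M₀ + N), a n * e (n * x r)‖ ^ 2 ≤
      (N + 1 + 2 / δ) * ∑ n ∈ Ioc M₀ (M₀ + N), ‖a n‖ ^ 2 := by
  classical
  -- parameters of the kernel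
  obtain ⟨M, hM⟩ : ∃ M : ℕ, M = N / 2 := ⟨_, rfl⟩
  obtain ⟨c, hc⟩ : ∃ c : ℤ, c = M₀ + N - M := ⟨_, rfl⟩
  obtain ⟨L, hL⟩ : ∃ L : ℕ, L = ⌈δ⁻¹⌉₊ := ⟨_, rfl⟩
  have hL0 : 0 < L := hL ▸ Nat.ceil_pos.2 (inv_pos.2 hδ)
  have hL0' : (0 : ℝ) < L := by exact_mod_cast hL0
  have hLge : δ⁻¹ ≤ L := hL ▸ Nat.le_ceil _
  have hLle : (L : ℝ) ≤ δ⁻¹ + 1 := hL ▸ (Nat.ceil_lt_add_one (inv_nonneg.2 hδ.le)).le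
  have h2M : 2 * M ≤ N := hM ▸ Nat.mul_div_le N 2
  set S : Finset ℤ := Ioc M₀ (M₀ + N) with hS
  set T : Finset ℤ := window c M L with hT
  have hplateau : ∀ n ∈ S, |n - c| ≤ (M : ℤ) := by
    intro n hn
    rw [hS, mem_Ioc] at hn
    rw [abs_le]
    omega
  have hST : S ⊆ T := by
    intro n hn
    have h := hplateau n hn
    rw [abs_le] at h
    rw [hT, window, mem_Icc]
    push_cast
    omega
  -- the vectors fed to the duality lemma
  set u : ℤ → ℂ := fun m => if m ∈ S then a m else 0 with hu
  set f : ι → ℤ → ℂ := fun r m => (Real.sqrt (trapW c M L m) : ℂ) * e (-(m * x r)) with hf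
  have hw1 : ∀ n ∈ S, trapW c M L n = 1 := fun n hn => trapW_eq_one c M L hL0 (hplateau n hn)
  have h_inner : ∀ r, ∑ m ∈ T, u m * conj (f r m) = ∑ n ∈ S, a n * e (n * x r) := by
    intro r
    have h : ∀ m ∈ T, u m * conj (f r m) = if m ∈ S then a m * e (m * x r) else 0 := by
      intro m _
      simp only [hu, hf]
      split_ifs with hm
      · rw [map_mul, Complex.conj_ofReal, conj_e, neg_neg, hw1 m hm, Real.sqrt_one]
        push_cast; ring
      · rw [zero_mul]
    rw [sum_congr rfl h, sum_ite_mem, inter_eq_right.2 hST]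
  have h_norm : ∑ m ∈ T, ‖u m‖ ^ 2 = ∑ n ∈ S, ‖a n‖ ^ 2 := by
    have h : ∀ m ∈ T, ‖u m‖ ^ 2 = if m ∈ S then ‖a m‖ ^ 2 else 0 := by
      intro m _; simp only [hu]; split_ifs <;> simp
    rw [sum_congr rfl h, sum_ite_mem, inter_eq_right.2 hST]
  have h_gram : ∀ r s, ∑ m ∈ T, f r m * conj (f s m) = trapK c M L (x s - x r) := by
    intro r s
    rw [trapK]
    refine sum_congr rfl fun m _ => ?_
    simp only [hf, map_mul, Complex.conj_ofReal, conj_e, neg_neg]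
    have hw0 := trapW_nonneg c M L m
    calc (Real.sqrt (trapW c M L m) : ℂ) * e (-(m * x r)) *
          ((Real.sqrt (trapW c M L m) : ℂ) * e (m * x s))
        = ((Real.sqrt (trapW c M L m) * Real.sqrt (trapW c M L m) : ℝ) : ℂ) *
            (e (-(m * x r)) * e (m * x s)) := by push_cast; ring
      _ = (trapW c M L m : ℂ) * e (m * (x s - x r)) := by
          rw [Real.mul_self_sqrt hw0, ← e_add]; congr 2; ring
  -- the row-sum bound `B`
  set B : ℝ := ((2 * M + L : ℕ) : ℝ) + ((L : ℝ) * δ ^ 2)⁻¹ with hB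
  have hB0 : 0 ≤ B := by positivity
  have hBrow : ∀ r ∈ R, ∑ s ∈ R, ‖∑ m ∈ T, f r m * conj (f s m)‖ ≤ B := by
    intro r hr
    simp only [h_gram]
    rw [← add_sum_erase R _ hr, sub_self, trapK_zero c M L hL0, Complex.norm_natCast, hB]
    exact add_le_add le_rfl (sum_erase_norm_trapK_le R x hδ hsep c M L hL0 hr)
  -- duality
  have hmain := duality R T u f hB0 hBrow
  simp only [h_inner, h_norm] at hmain
  refine hmain.trans ?_
  rw [mul_comm]
  refine mul_le_mul_of_nonneg_right ?_ (sum_nonneg fun n _ => by positivity)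
  -- `B ≤ N + 1 + 2/δ`
  have h1 : ((L : ℝ) * δ ^ 2)⁻¹ ≤ δ⁻¹ := by
    rw [inv_le_inv₀ (by positivity) hδ]
    calc δ = δ⁻¹ * δ ^ 2 := by field_simp
      _ ≤ L * δ ^ 2 := mul_le_mul_of_nonneg_right hLge (by positivity)
  have h2 : ((2 * M + L : ℕ) : ℝ) ≤ N + L := by exact_mod_cast Nat.add_le_add_right h2M L
  calc B ≤ (N + L) + δ⁻¹ := add_le_add h2 h1
    _ ≤ N + (δ⁻¹ + 1) + δ⁻¹ := by linarith
    _ = N + 1 + 2 / δ := by ring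

end WellSpaced

/-! ### The Farey points `b/q` -/

/-- The Farey fractions `b/q`, `1 ≤ q ≤ Q`, `0 ≤ b < q`, `(b, q) = 1`, are `Q⁻²`-spaced modulo `1`.
[folklore] -/
theorem farey_spacing {Q q q' b b' : ℕ} (hq : q ∈ Icc 1 Q) (hq' : q' ∈ Icc 1 Q)
    (hb : b < q) (hb' : b' < q') (hbq : b.Coprime q) (hbq' : b'.Coprime q')
    (hne : (⟨q, b⟩ : (_ : ℕ) × ℕ) ≠ ⟨q', b'⟩) (k : ℤ) :
    ((Q : ℝ) ^ 2)⁻¹ ≤ |(b' : ℝ) / q' - b / q - k| := by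
  rw [mem_Icc] at hq hq'
  have hq0 : (0 : ℝ) < q := by exact_mod_cast hq.1
  have hq0' : (0 : ℝ) < q' := by exact_mod_cast hq'.1
  -- the numerator is a nonzero integer
  have hnum : ((b' : ℤ) * q - b * q' - k * q * q') ≠ 0 := by
    intro h
    have h1 : (q : ℤ) ∣ (b : ℤ) * q' := ⟨b' - k * q', by linear_combination -h⟩
    have h2 : (q' : ℤ) ∣ (b' : ℤ) * q := ⟨b + k * q, by linear_combination h⟩
    have h1' : q ∣ q' := hbq.symm.dvd_of_dvd_mul_left (by exact_mod_cast h1)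
    have h2' : q' ∣ q := hbq'.symm.dvd_of_dvd_mul_left (by exact_mod_cast h2)
    have hqq : q = q' := Nat.dvd_antisymm h1' h2'
    subst hqq
    have h3 : ((b' : ℤ) - b - k * q) * q = 0 := by linear_combination h
    have h4 : (b' : ℤ) - b - k * q = 0 := by
      rcases mul_eq_zero.1 h3 with h3 | h3
      · exact h3
      · exfalso; exact absurd (by exact_mod_cast h3 : q = 0) (by omega)
    have hk : k = 0 := by
      by_contra hk
      have : (q : ℤ) ≤ |(b' : ℤ) - b| := by
        calc (q : ℤ) ≤ |k| * q := le_mul_of_one_le_left (by positivity) (Int.one_le_abs hk)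
          _ = |k * q| := by rw [abs_mul, Nat.abs_cast]
          _ = |(b' : ℤ) - b| := by rw [show k * (q : ℤ) = b' - b by linear_combination -h4]
      have : |(b' : ℤ) - b| < q := by rw [abs_lt]; constructor <;> omega
      omega
    subst hk
    have : b = b' := by omega
    exact hne (by subst this; rfl)
  have hnum' : (1 : ℝ) ≤ |(((b' : ℤ) * q - b * q' - k * q * q' : ℤ) : ℝ)| := by
    rw [← Int.cast_abs]; exact_mod_cast Int.one_le_abs hnum
  have hrepr : (b' : ℝ) / q' - b / q - k = (((b' : ℤ) * q - b * q' - k * q * q' : ℤ) : ℝ) / (q * q') := by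
    push_cast; field_simp; try ring
  rw [hrepr, abs_div, abs_of_pos (by positivity : (0 : ℝ) < q * q')]
  rw [le_div_iff₀ (by positivity)]
  calc ((Q : ℝ) ^ 2)⁻¹ * (q * q') ≤ ((Q : ℝ) ^ 2)⁻¹ * (Q * Q) := by
        gcongr
        · exact_mod_cast hq.2
        · exact_mod_cast hq'.2
    _ = 1 := by
        have hQ : (0 : ℝ) < Q := by exact_mod_cast (show 0 < Q by omega)
        field_simp
    _ ≤ _ := hnum'

/-- **The large sieve inequality at the Farey points** (weak constant): for complex `a_n`
supported on `M₀ < n ≤ M₀ + N`,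
`∑_{q ≤ Q} ∑_{b mod q, (b,q)=1} |∑_n a_n e(bn/q)|² ≤ (N + 1 + 2Q²) ∑_n |a_n|²`
(same shape as `Literature.NumberTheory.Sieve.large_sieve_inequality`, parity.S33, whose constant `Q² + N - 1` is
optimal; here from `largeSieve_wellSpaced` with `δ = Q⁻²`). [cite: Huxley1972, Ch. 7, (7.8)] -/
theorem largeSieve_farey (a : ℤ → ℂ) (M₀ : ℤ) (N Q : ℕ) :
    ∑ q ∈ Icc 1 Q, ∑ b ∈ range q with b.Coprime q,
        ‖∑ n ∈ Ioc M₀ (M₀ + N), a n * (𝐞 ((b : ℝ) * n / q) : ℂ)‖ ^ 2 ≤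
      ((N : ℝ) + 1 + 2 * (Q : ℝ) ^ 2) * ∑ n ∈ Ioc M₀ (M₀ + N), ‖a n‖ ^ 2 := by
  rcases Nat.eq_zero_or_pos Q with rfl | hQ
  · simp only [show Icc 1 0 = (∅ : Finset ℕ) by rfl, sum_empty]
    exact mul_nonneg (by positivity) (sum_nonneg fun n _ => by positivity)
  set R : Finset ((_ : ℕ) × ℕ) := (Icc 1 Q).sigma fun q => (range q).filter fun b => b.Coprime q
    with hR
  set x : ((_ : ℕ) × ℕ) → ℝ := fun p => (p.2 : ℝ) / p.1 with hx
  have hδ : (0 : ℝ) < ((Q : ℝ) ^ 2)⁻¹ := by positivity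
  have hsep : ∀ r ∈ R, ∀ s ∈ R, r ≠ s → ∀ k : ℤ, ((Q : ℝ) ^ 2)⁻¹ ≤ |x s - x r - k| := by
    rintro ⟨q, b⟩ hr ⟨q', b'⟩ hs hne k
    simp only [hR, mem_sigma, mem_filter, mem_range] at hr hs
    exact farey_spacing hr.1 hs.1 hr.2.1 hs.2.1 hr.2.2 hs.2.2 hne k
  have h := largeSieve_wellSpaced R x hδ hsep a M₀ N
  rw [hR, sum_sigma, div_inv_eq_mul] at h
  simp only [hx] at h
  convert h using 4 with q _ b _
  refine congr_arg _ (sum_congr rfl fun n _ => ?_)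
  simp only [e]; congr 3; ring

end Literature.NumberTheory.Sieve.LargeSieve
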